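import Literature.NumberTheory.LFunctions.WeilFirstPrimeOddMarginDKappa
import Literature.NumberTheory.LFunctions.WeilFirstPrimeCertificateCCheck
import Literature.NumberTheory.LFunctions.WeilFirstPrimeCertificateCBlock1
import Literature.NumberTheory.LFunctions.WeilFirstPrimeOddMarginDRows0
import Literature.NumberTheory.LFunctions.WeilFirstPrimeOddMarginDRows1
import Literature.NumberTheory.LFunctions.WeilFirstPrimeOddMarginDRows2
import Literature.NumberTheory.LFunctions.WeilFirstPrimeOddMarginDRows3
import Literature.NumberTheory.LFunctions.WeilFirstPrimeOddMarginDRows4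
import Literature.NumberTheory.LFunctions.WeilFirstPrimeOddMarginDRows5
import Literature.NumberTheory.LFunctions.WeilFirstPrimeOddMarginDRows6
import Literature.NumberTheory.LFunctions.WeilFirstPrimeOddMarginDRows7
import Literature.NumberTheory.LFunctions.WeilFirstPrimeOddMarginDRows8
import Literature.NumberTheory.LFunctions.WeilFirstPrimeOddMarginDRows9
import HarnessLib

/-!
# Odd-sector margin certificate D: assembly of the checks

`weilCertOddD` passes the cell check and the moment check (both LITERALLY those of `weilCert3C`), the scalar
side conditions, and its ODD block passes `WeilCert.checkBlockK` at the lowered Bessel coefficient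
`κ' = weilCertOddDKappa'` (`D C = I` rows: those of `weilCert3C`, definitionally; dominance rows: the sibling
`…DRows*.lean` files; `WeilCert.checkBlockK_of_rows`). These Booleans are what the odd-margin soundness
theorem consumes. Pure proof file; nothing is asserted.
-/

noncomputable section

namespace Literature.NumberTheory.LFunctions

/-- **Kernel check of the cells** of certificate D (= the Stage-C cells check, same level, cut-off and cells). [folklore] -/
theorem checkCells_weilCertOddD :
    checkCells₃ weilCertOddD.base.prec weilCertOddD.j weilCertOddD.base.wL weilCertOddD.base.T weilCertOddD.base.mwT weilCertOddD.cells = true :=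
  checkCells_weilCert3C

/-- **The moment table of certificate D is correct** (even entries `q ≤ 198`). [folklore] -/
theorem checkNu_weilCertOddD : weilCertOddD.checkNu = true :=
  checkNu_weilCert3C

/-- **The odd block of certificate D passes `checkBlockK` at `κ'`.** [folklore] -/
theorem checkBlock1_weilCertOddD : weilCertOddD.base.checkBlockK weilCertOddD.nuTab weilCertOddDKappa' 1 = true := by
  refine WeilCert.checkBlockK_of_rows (fun i hi ↦ ?_) (fun i hi ↦ ?_)
  · have hi' : i < 50 := hi
    interval_cases i
    · exact checkDCRow1_0_weilCert3C
    · exact checkDCRow1_1_weilCert3C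
    · exact checkDCRow1_2_weilCert3C
    · exact checkDCRow1_3_weilCert3C
    · exact checkDCRow1_4_weilCert3C
    · exact checkDCRow1_5_weilCert3C
    · exact checkDCRow1_6_weilCert3C
    · exact checkDCRow1_7_weilCert3C
    · exact checkDCRow1_8_weilCert3C
    · exact checkDCRow1_9_weilCert3C
    · exact checkDCRow1_10_weilCert3C
    · exact checkDCRow1_11_weilCert3C
    · exact checkDCRow1_12_weilCert3C
    · exact checkDCRow1_13_weilCert3C
    · exact checkDCRow1_14_weilCert3C
    · exact checkDCRow1_15_weilCert3C
    · exact checkDCRow1_16_weilCert3C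
    · exact checkDCRow1_17_weilCert3C
    · exact checkDCRow1_18_weilCert3C
    · exact checkDCRow1_19_weilCert3C
    · exact checkDCRow1_20_weilCert3C
    · exact checkDCRow1_21_weilCert3C
    · exact checkDCRow1_22_weilCert3C
    · exact checkDCRow1_23_weilCert3C
    · exact checkDCRow1_24_weilCert3C
    · exact checkDCRow1_25_weilCert3C
    · exact checkDCRow1_26_weilCert3C
    · exact checkDCRow1_27_weilCert3C
    · exact checkDCRow1_28_weilCert3C
    · exact checkDCRow1_29_weilCert3C
    · exact checkDCRow1_30_weilCert3C
    · exact checkDCRow1_31_weilCert3C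
    · exact checkDCRow1_32_weilCert3C
    · exact checkDCRow1_33_weilCert3C
    · exact checkDCRow1_34_weilCert3C
    · exact checkDCRow1_35_weilCert3C
    · exact checkDCRow1_36_weilCert3C
    · exact checkDCRow1_37_weilCert3C
    · exact checkDCRow1_38_weilCert3C
    · exact checkDCRow1_39_weilCert3C
    · exact checkDCRow1_40_weilCert3C
    · exact checkDCRow1_41_weilCert3C
    · exact checkDCRow1_42_weilCert3C
    · exact checkDCRow1_43_weilCert3C
    · exact checkDCRow1_44_weilCert3C
    · exact checkDCRow1_45_weilCert3C
    · exact checkDCRow1_46_weilCert3C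
    · exact checkDCRow1_47_weilCert3C
    · exact checkDCRow1_48_weilCert3C
    · exact checkDCRow1_49_weilCert3C
  · have hi' : i < 50 := hi
    interval_cases i
    · exact checkDomRow1_0_weilCertOddD
    · exact checkDomRow1_1_weilCertOddD
    · exact checkDomRow1_2_weilCertOddD
    · exact checkDomRow1_3_weilCertOddD
    · exact checkDomRow1_4_weilCertOddD
    · exact checkDomRow1_5_weilCertOddD
    · exact checkDomRow1_6_weilCertOddD
    · exact checkDomRow1_7_weilCertOddD
    · exact checkDomRow1_8_weilCertOddD
    · exact checkDomRow1_9_weilCertOddD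
    · exact checkDomRow1_10_weilCertOddD
    · exact checkDomRow1_11_weilCertOddD
    · exact checkDomRow1_12_weilCertOddD
    · exact checkDomRow1_13_weilCertOddD
    · exact checkDomRow1_14_weilCertOddD
    · exact checkDomRow1_15_weilCertOddD
    · exact checkDomRow1_16_weilCertOddD
    · exact checkDomRow1_17_weilCertOddD
    · exact checkDomRow1_18_weilCertOddD
    · exact checkDomRow1_19_weilCertOddD
    · exact checkDomRow1_20_weilCertOddD
    · exact checkDomRow1_21_weilCertOddD
    · exact checkDomRow1_22_weilCertOddD
    · exact checkDomRow1_23_weilCertOddD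
    · exact checkDomRow1_24_weilCertOddD
    · exact checkDomRow1_25_weilCertOddD
    · exact checkDomRow1_26_weilCertOddD
    · exact checkDomRow1_27_weilCertOddD
    · exact checkDomRow1_28_weilCertOddD
    · exact checkDomRow1_29_weilCertOddD
    · exact checkDomRow1_30_weilCertOddD
    · exact checkDomRow1_31_weilCertOddD
    · exact checkDomRow1_32_weilCertOddD
    · exact checkDomRow1_33_weilCertOddD
    · exact checkDomRow1_34_weilCertOddD
    · exact checkDomRow1_35_weilCertOddD
    · exact checkDomRow1_36_weilCertOddD
    · exact checkDomRow1_37_weilCertOddD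
    · exact checkDomRow1_38_weilCertOddD
    · exact checkDomRow1_39_weilCertOddD
    · exact checkDomRow1_40_weilCertOddD
    · exact checkDomRow1_41_weilCertOddD
    · exact checkDomRow1_42_weilCertOddD
    · exact checkDomRow1_43_weilCertOddD
    · exact checkDomRow1_44_weilCertOddD
    · exact checkDomRow1_45_weilCertOddD
    · exact checkDomRow1_46_weilCertOddD
    · exact checkDomRow1_47_weilCertOddD
    · exact checkDomRow1_48_weilCertOddD
    · exact checkDomRow1_49_weilCertOddD

end Literature.NumberTheory.LFunctions
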